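import Summits.ABC.ABC.Theorems.IsogenyGlueCongruenceMazurKenkuBoundOfEightTables
import Literature.NumberTheory.EllipticCurves.KleinFrickeLevelSevenJZero
import HarnessLib

/-!
# Route `IsogenyGlueCongruence`, glue item `MazurKenkuBoundGlue` (stmt-ABC-18227) of the split crux
# `MazurKenkuBound` — CLOSED

`MazurCor44 → KenkuPrintedLevels → KenkuCompositeTables → KenkuLevelFortyNine → MazurKenkuBound`:
re-sort the four children (crux-strategist s2's split by formalisation method: A = Mazur 1978
Cor. 4.4; B = the seven prime `j`-tables ∧ the five smooth levels `26, 35, 65, 125, 169`;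
C₁ = the composite tables `15, 21, 27`; C₂ = level `49`) into the three printed inputs
`(h44, hT8, hL6)` of the landed closer `mazurKenkuBound_of_eight` (lead c22, p166061: the crux from
Cor. 4.4, the eight non-`15, 21` table levels, the six smooth levels and Klein–Fricke at `7` over `ℚ`,
the last supplied inline from the axiom-clean tree theorems
`Isogeny.exists_j_eq_klein_seven_of_degree_eq_seven` and `Isogeny.j_ne_zero_of_degree_eq_seven_rat`). The eleven prime rows and
the level-`27` row are rows of `kenkuIsogenyJTable` (finite check).
[cite: Kenku1982, proof of Thm. 1, p. 200] [cite: Mazur1978, Thm. 1 and Cor. 4.4]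
-/

set_option linter.dupNamespace false

noncomputable section

open scoped Classical

open WeierstrassCurve
open Literature.NumberTheory.EllipticCurves

namespace Summit.ABC.ABC.Theorems

/-- The eleven prime rows and the level-`27` row of the children are rows of `kenkuIsogenyJTable`
(finite check). [cite: Kenku1982, proof of Thm. 1, p. 200] -/
theorem splitRows_sub_kenkuIsogenyJTable :
    ∀ r ∈ ({((11 : ℕ), (-32768 : ℚ)), (11, -121), (11, -24729001), (17, -297756989 / 2),
        (17, -882216989 / 131072), (19, -884736), (37, -9317), (37, -162677523113838677),
        (43, -884736000), (67, -147197952000), (163, -262537412640768000),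
        (15, -25 / 2), (15, -349938025 / 8), (15, -121945 / 32), (15, 46969655 / 32768),
        (21, -140625 / 8), (21, 3375 / 2), (21, -1159088625 / 2097152), (21, -189613868625 / 128),
        (27, -12288000)} : Finset (ℕ × ℚ)),
      r ∈ kenkuIsogenyJTable := by
  decide +kernel

/-- **Glue item `MazurKenkuBoundGlue` (stmt-ABC-18227), proved**: the four children of the split
imply the crux `MazurKenkuBound`, through the landed `mazurKenkuBound_of_eight` (axiom-clean path).
[cite: Kenku1982, proof of Thm. 1, p. 200] [cite: Mazur1978, Thm. 1 and Cor. 4.4]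
[cite: PastenShimura2024, §3 p. 13] -/
theorem mazurKenkuBoundGlue_proof :
    Summit.ABC.ABC.Theses.IsogenyGlueCongruence.MazurKenkuBoundGlue := by
  intro hA hB hC₁ hC₂
  refine mazurKenkuBound_of_eight hA ?_ ?_
    (fun W W' _ φ h7 ↦ φ.exists_j_eq_klein_seven_of_degree_eq_seven h7
      (φ.j_ne_zero_of_degree_eq_seven_rat h7))
  · -- `hT8`: the eight non-`15, 21` table levels
    intro V V' _ _ ψ hψ hmem
    have hsplit : ∀ n ∈ ({11, 17, 19, 27, 37, 43, 67, 163} : Finset ℕ),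
        n = 27 ∨ n ∈ ({11, 17, 19, 37, 43, 67, 163} : Finset ℕ) := by decide
    rcases hsplit _ hmem with h27 | h7
    · have h := hC₁ V V' ψ hψ (by rw [h27]; decide)
      exact splitRows_sub_kenkuIsogenyJTable _ (Finset.mem_of_subset (by decide +kernel) h)
    · have h := hB.1 V V' ψ hψ h7
      exact splitRows_sub_kenkuIsogenyJTable _ (Finset.mem_of_subset (by decide +kernel) h)
  · -- `hL6`: the six smooth levels
    intro V V' _ _ ψ hψ hmem
    have hsplit : ∀ n ∈ ({26, 35, 49, 65, 125, 169} : Finset ℕ),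
        n = 49 ∨ n ∈ ({26, 35, 65, 125, 169} : Finset ℕ) := by decide
    rcases hsplit _ hmem with h49 | h5
    · exact hC₂ V V' ψ hψ h49
    · exact hB.2 V V' ψ hψ h5

end Summit.ABC.ABC.Theorems

end
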